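import Summits.BirchSwinnertonDyer.BirchSwinnertonDyer.Theorems.PrintCf2RamifiedOffTYZLevelTwoGenusQuotient
import Summits.BirchSwinnertonDyer.Rank1Residual.P2.PrintCf2GenusPeriodTransferLayer
import HarnessLib

/-!
# Route `PrintCf2`, crux stmt-BirchSwinnertonDyer-20509 `RamifiedOffTYZOfFacts` — THE GENUS CHARACTER OF THE GENUS POINT:
# on `Gal(ℍ′_n/K_n(i))` the cocycle `g ↦ g·P(n) − P(n)` is a HOMOMORPHISM into the torsion; on the lower-half locus it equals
# `m̄·χ_{Q₁}` (`χ_{Q₁}(g) = g·Q₁ − Q₁ ∈ {0, τ(1)}`, the genus character of the half-generator); hence, wherever some `g₀` moves `Q₁`,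
# **C⁺ at `n` ⟺ `g₀` moves `P(n)`** — one bit at one genus element
# (cell `bsd-print-cf2`, LEAD of 20509 g11, line `offtyz-v7`, lineage cycle 12, sequel of `…LevelTwoGenusQuotient`; fact-free, Theses-free, no `def`)

HONEST FRAMING (crux 20509 = `𝔅_ram → WAllCornerFTwoRamifiedOffTYZProved`, DECIDING, OPEN AS A CLASS): bookkeeping on
Tian–Yuan–Zhang's Theorem 3.5 main clause and Lemma 3.18 taken as HYPOTHESES on the displayed data (`D.thm35Main`,
`D.scriptLSpec`, `D.lemma318`, arXiv:1411.4728 §3 AS PRINTED), GZK by name, the W2 descent kernel, g3's `ρ`-free main clause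
(p665240), g4's Galois motion (p671505), this seat's `…LevelTwoHalves` (p725894) / `…LevelTwoGenusQuotient` (p726233) and the
`galPt` plumbing of `Rank1Residual/P2/PrintCf2GenusPeriodTransferLayer` (`galPt_mul`).  Nothing is asserted; C⁺ =
`stub_offTYZ_levelTwoScriptLExact` (= item stmt-BirchSwinnertonDyer-23431) stays open.

Notation: `c_P(g) := g·P(n) − P(n)`, `χ_{Q₁}(g) := g·Q₁ − Q₁` for a half `Q₁` of the twisted Mordell–Weil generator
(`φ_H(Q₁) = ι Θ_E(R)`); both written out, no `def`.

* §1 `galPt_half_sub_eq_zero_or_eq_tauOne`, `galPt_half_sub_mul`, `galPt_half_sub_eq_of_φH_eq`: for `g` fixing `√−n`,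
  `χ_{Q₁}(g) ∈ {0, τ(1)}`, `χ_{Q₁}` is multiplicative-to-additive on such `g`, and does not depend on the chosen half
  (`φ` is defined over `ℚ`, `ker φ_H = {0, τ(1)}`, `τ(1)` rational).  `χ_{Q₁}` is the quadratic (genus) character cut out by the
  `φ`-descent class of the generator `R` read over `K_n`.
* §2 `galPt_genusPoint_sub_mul`: for ODD square-free `n` (rank `≤ 1`, `𝓛(n) ≠ 0`, Thm 3.5, Lemma 3.18) and `g(i) = i`,
  `h(√−n) = √−n`: **`c_P(gh) = c_P(g) + c_P(h)`** (`c_P(h)` is torsion by `…LevelTwoGenusQuotient` §3, hence `g`-fixed); so on the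
  stabiliser of `i` and `√−n` the genus point defines a HOMOMORPHISM into `A[(1+i)³]`, and `2·c_P(g) = c_P(g²)`
  (`two_smul_galPt_genusPoint_sub`): where the squares are silent (g10, `s ≥ 2`), `c_P(g) ∈ A[2] = {0, τ(1), (±2i,0)}`
  (`galPt_genusPoint_sub_mem_of_sq`).
* §3 ON THE LINE (`P(n) − m·Q₁ ∈ tors`, i.e. the lower half when such `m` exists): `galPt_genusPoint_sub_eq_zsmul_half_sub` —
  **`c_P(g) = m·χ_{Q₁}(g)`** for `g(i) = i` (any action on `√−n`); with `g(√−n) = √−n`: `= 0` for `m` even, `= χ_{Q₁}(g)` for `m` odd;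
  `galPt_genusPoint_eq_of_half_fixed_of_mem_line` — a `g` fixing `i` and `Q₁` fixes `P(n)`: **on the line the only possible movers of
  `P(n)` in `Gal(ℍ′_n/ℚ(i))` are those moving the half-generator.**
* §4 **`levelTwo_iff_galPt_genusPoint_ne_of_two_dvd`**: square-free odd `n ≡ 5, 7 (mod 8)` of analytic rank one, GZK, Thm 3.5, integrality,
  Lemma 3.18; GIVEN the lower half (`2 ∣ L` for all sign choices) and ONE `g₀ ∈ Aut_ℚ(ℍ′_n)` fixing `i` and `√−n` with `g₀·Q₁ ≠ Q₁`:
  **C⁺ at `n` ⟺ `g₀·P(n) ≠ P(n)`** (⟹: `P ≡ m·Q₁`, `m` odd, so `c_P(g₀) = χ_{Q₁}(g₀) = τ(1)`; ⟸: g4's door `not_four_dvd_of_galPt_genusPoint_ne`).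
  `galPt_genusPoint_sub_eq_galPt_half_sub_of_levelTwo` — C⁺ ⟹ `c_P = χ_{Q₁}` on the stabiliser of `i` (MATCHING of the two genus characters);
  `galPt_genusPoint_eq_of_four_dvd_on_line` is g4's B-locus reading restated through §3 (`m` even ⟹ `c_P = 0`).

What this buys the line (LEAD census, crux 20509): at `s = 3`, after g10's silence and this seat's §3 circularity checks, the WHOLE
residual Layer-1 object is one homomorphism `c_P : Gal(ℍ′_n/K_n(i)) → A[2]` plus one class in `H¹(⟨i ↦ −i⟩, T) ≅ ℤ/2`; on the lower-half
locus `c_P = m̄·χ_{Q₁}`, so the `i`-flipping door of `…LevelTwoGenusQuotient` is silent there and the `i`-fixing door fires EXACTLY when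
`m` is odd AND `χ_{Q₁} ≠ 0` on the stabiliser — i.e. C⁺ on `{lower half} ∩ {χ_{Q₁} ≢ 0}` is the single bit `c_P(g₀) = τ(1)` at the genus
element `g₀` detecting the `φ`-class of the generator; on `{χ_{Q₁} ≡ 0}` no Galois motion inside `ℍ′_n` can certify C⁺ (Layer ≥ 2 in
the strict sense).  BSD₂ predicts `c_P(g₀) = τ(1)` on every G-member with `χ_{Q₁}(g₀) ≠ 0` (instrument target).  Beyond-print theorem: NO;
C⁺ stays open; BSD is not proved by any of this; no class is closed by this file.

References: [cite: TianYuanZhang2017, Thm. 3.5 (p0011 L94–L100), Lemma 3.16 (p0017 L98–L113), Lemma 3.18 (p0017 L152–L153), §3.1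
(p0011 L27–L36)]; [cite: SilvermanAEC2009, III.4.5, X.4.9]; [cite: Darmon2004, Thm. 3.22] (GZK); tree: this seat's `…LevelTwoHalves`,
`…LevelTwoGenusQuotient`; g3 `…LevelTwoHalfGenerator`; g4 `…GaloisMotion`; `Rank1Residual/P2/PrintCf2GenusPeriodTransferLayer` (`galPt_mul`).
-/

noncomputable section

open scoped Classical

open WeierstrassCurve WeierstrassCurve.Affine Literature.NumberTheory.EllipticCurves
  Literature.NumberTheory.EllipticCurves.Rank1Residual Summit.BirchSwinnertonDyer.Rank1Residual
  Literature.NumberTheory.EllipticCurves.TianYuanZhang2017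
  Literature.NumberTheory.EllipticCurves.TianYuanZhang2017.W2
  Summit.BirchSwinnertonDyer.PrintCf2.LevelTwoHalfGenerator
  Summit.BirchSwinnertonDyer.PrintCf2.GaloisMotion
  Summit.BirchSwinnertonDyer.PrintCf2.LevelTwoHalves
  Summit.BirchSwinnertonDyer.PrintCf2.LevelTwoGenusQuotient
  Summit.BirchSwinnertonDyer.Rank1Residual.P2.ThetaDescent
  Summit.BirchSwinnertonDyer.Rank1Residual.P2.GenusPeriodTransferLayer

set_option autoImplicit false

namespace Summit.BirchSwinnertonDyer.PrintCf2.GenusCharacter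

variable {n : ℕ}

/-! ## §1 The genus character `χ_{Q₁}(g) = g·Q₁ − Q₁` of a half of the twisted generator -/

/-- `φ_H` is Galois-equivariant and `φ_H(Q₁)` is `K_n`-rational: an automorphism fixing `√−n` fixes `φ_H(Q₁)`.
[cite: TianYuanZhang2017, §3.1 (p0011 L27–L36)] [cite: SilvermanAEC2009, III.4.5] -/
theorem φH_galPt_half_eq (D : GenusPointData n) (hn : n ∈ n.divisors) (g : D.H ≃ₐ[ℚ] D.H)
    (hgK : g (D.sqrtNeg n) = D.sqrtNeg n) {Q₁ : APoint D.H} {X : A2Point (GenusField n)}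
    (hQ₁ : φH D Q₁ = Point.map (W' := curveA.twoIsogenyCodomain) (D.embK n hn) X) :
    φH D (D.galPt g Q₁) = φH D Q₁ := by
  change curveA.twoIsogenyPointsHom D.H (Point.map (g : D.H →ₐ[ℚ] D.H) Q₁) = _
  rw [← map_twoIsogenyPointsHom]
  change Point.map (g : D.H →ₐ[ℚ] D.H) (φH D Q₁) = φH D Q₁
  rw [hQ₁, Point.map_map, algHom_comp_embK_eq D hn g hgK]

/-- **`χ_{Q₁}(g) ∈ {0, τ(1)}`** for every `g` fixing `√−n` (`ker φ_H = {0, τ(1)}`). [cite: TianYuanZhang2017, Lemma 3.16 (p0017 L105–L113)] -/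
theorem galPt_half_sub_eq_zero_or_eq_tauOne (D : GenusPointData n) (hn : n ∈ n.divisors) (g : D.H ≃ₐ[ℚ] D.H)
    (hgK : g (D.sqrtNeg n) = D.sqrtNeg n) {Q₁ : APoint D.H} {X : A2Point (GenusField n)}
    (hQ₁ : φH D Q₁ = Point.map (W' := curveA.twoIsogenyCodomain) (D.embK n hn) X) :
    D.galPt g Q₁ - Q₁ = 0 ∨ D.galPt g Q₁ - Q₁ = tauOne := by
  apply (φH_eq_zero_iff D _).mp
  rw [map_sub, φH_galPt_half_eq D hn g hgK hQ₁, sub_self]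

/-- **`χ_{Q₁}` is additive on the stabiliser of `√−n`**: `χ(gh) = χ(g) + χ(h)` (`τ(1)` is rational, hence fixed by `g`).
[cite: TianYuanZhang2017, Lemma 3.16 (p0017 L105–L113), §3.2 (p0012 L8–L18)] -/
theorem galPt_half_sub_mul (D : GenusPointData n) (hn : n ∈ n.divisors) (g h : D.H ≃ₐ[ℚ] D.H)
    (hhK : h (D.sqrtNeg n) = D.sqrtNeg n) {Q₁ : APoint D.H} {X : A2Point (GenusField n)}
    (hQ₁ : φH D Q₁ = Point.map (W' := curveA.twoIsogenyCodomain) (D.embK n hn) X) :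
    D.galPt (g * h) Q₁ - Q₁ = (D.galPt g Q₁ - Q₁) + (D.galPt h Q₁ - Q₁) := by
  have hfix : D.galPt g (D.galPt h Q₁ - Q₁) = D.galPt h Q₁ - Q₁ := by
    rcases galPt_half_sub_eq_zero_or_eq_tauOne D hn h hhK hQ₁ with e | e
    · rw [e, map_zero]
    · rw [e]; exact galPt_tauOne D g
  have e : D.galPt (g * h) Q₁ = D.galPt g (D.galPt h Q₁ - Q₁) + D.galPt g Q₁ := by
    rw [galPt_mul, ← map_add, sub_add_cancel]
  rw [e, hfix]; abel

/-- **`χ_{Q₁}` does not depend on the half**: two points with the same `φ_H`-image differ by `0` or `τ(1)`, both fixed by `g`.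
[cite: TianYuanZhang2017, Lemma 3.16 (p0017 L105–L113)] -/
theorem galPt_half_sub_eq_of_φH_eq (D : GenusPointData n) (g : D.H ≃ₐ[ℚ] D.H) {Q₁ Q₁' : APoint D.H}
    (h : φH D Q₁ = φH D Q₁') : D.galPt g Q₁ - Q₁ = D.galPt g Q₁' - Q₁' := by
  have hu : Q₁ - Q₁' = 0 ∨ Q₁ - Q₁' = tauOne := (φH_eq_zero_iff D _).mp (by rw [map_sub, h, sub_self])
  have hfix : D.galPt g (Q₁ - Q₁') = Q₁ - Q₁' := by
    rcases hu with e | e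
    · rw [e, map_zero]
    · rw [e]; exact galPt_tauOne D g
  have e : Q₁ = (Q₁ - Q₁') + Q₁' := by abel
  conv_lhs => rw [e, map_add, hfix]
  abel

/-! ## §2 `c_P` is a homomorphism on the stabiliser of `i` and `√−n` -/

/-- **`c_P(gh) = c_P(g) + c_P(h)`** for `g(i) = i` and `h(√−n) = √−n` — ODD square-free `n`, `rank E_n(ℚ) ≤ 1`, `𝓛(n) ≠ 0`, Thm 3.5's
displayed main clause and Lemma 3.18 (`c_P(h)` is torsion, `…LevelTwoGenusQuotient`, and `g` fixes the torsion).
[cite: TianYuanZhang2017, Thm. 3.5 (p0011 L94–L100), Lemma 3.18 (p0017 L152–L153)] -/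
theorem galPt_genusPoint_sub_mul (hsq : Squarefree n) [(congruentNumberCurve n).IsElliptic] (hodd : Odd n)
    (hr1 : (congruentNumberCurve n).mordellWeilRank ≤ 1) (D : GenusPointData n) (h35 : D.thm35Main)
    (hL0 : D.scriptL n ≠ 0) (h318 : D.lemma318) (g h : D.H ≃ₐ[ℚ] D.H) (hgi : g D.im = D.im)
    (hhK : h (D.sqrtNeg n) = D.sqrtNeg n) :
    D.galPt (g * h) (D.P n) - D.P n = (D.galPt g (D.P n) - D.P n) + (D.galPt h (D.P n) - D.P n) := by
  have ht : IsOfFinAddOrder (D.galPt h (D.P n) - D.P n) :=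
    galPt_genusPoint_sub_isOfFinAddOrder hsq hr1 D h35 hL0 h hhK
  have hfix : D.galPt g (D.galPt h (D.P n) - D.P n) = D.galPt h (D.P n) - D.P n :=
    galPt_eq_self_of_isOfFinAddOrder D hodd h318 g hgi ht
  have e : D.galPt (g * h) (D.P n) = D.galPt g (D.galPt h (D.P n) - D.P n) + D.galPt g (D.P n) := by
    rw [galPt_mul, ← map_add, sub_add_cancel]
  rw [e, hfix]; abel

/-- **`2·c_P(g) = c_P(g²)`** for `g` fixing `i` and `√−n` (same data). [cite: TianYuanZhang2017, Thm. 3.5 (p0011 L94–L100), Lemma 3.18 (p0017 L152–L153)] -/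
theorem two_smul_galPt_genusPoint_sub (hsq : Squarefree n) [(congruentNumberCurve n).IsElliptic] (hodd : Odd n)
    (hr1 : (congruentNumberCurve n).mordellWeilRank ≤ 1) (D : GenusPointData n) (h35 : D.thm35Main)
    (hL0 : D.scriptL n ≠ 0) (h318 : D.lemma318) (g : D.H ≃ₐ[ℚ] D.H) (hgi : g D.im = D.im)
    (hgK : g (D.sqrtNeg n) = D.sqrtNeg n) :
    (2 : ℕ) • (D.galPt g (D.P n) - D.P n) = D.galPt (g * g) (D.P n) - D.P n := by
  rw [two_nsmul, galPt_genusPoint_sub_mul hsq hodd hr1 D h35 hL0 h318 g g hgi hgK]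

/-- **Where the square is silent, `c_P(g)` is a `2`-torsion point**: if `g²` fixes `P(n)` (g10's silence theorems supply this at
`s ≥ 2`) then `c_P(g) ∈ A[2] = {0, τ(1), (2i,0), (−2i,0)}` (same data). [cite: TianYuanZhang2017, Lemma 3.16 (p0017 L98–L113), Lemma 3.18 (p0017 L152–L153)] -/
theorem galPt_genusPoint_sub_mem_of_sq (hsq : Squarefree n) [(congruentNumberCurve n).IsElliptic] (hodd : Odd n)
    (hr1 : (congruentNumberCurve n).mordellWeilRank ≤ 1) (D : GenusPointData n) (h35 : D.thm35Main)
    (hL0 : D.scriptL n ≠ 0) (h318 : D.lemma318) (g : D.H ≃ₐ[ℚ] D.H) (hgi : g D.im = D.im)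
    (hgK : g (D.sqrtNeg n) = D.sqrtNeg n) (hsq2 : D.galPt (g * g) (D.P n) = D.P n) :
    D.galPt g (D.P n) - D.P n = 0 ∨ D.galPt g (D.P n) - D.P n = tauOne ∨
      D.galPt g (D.P n) - D.P n = tPlus D.im D.im_sq ∨ D.galPt g (D.P n) - D.P n = tMinus D.im D.im_sq := by
  apply P2.ThetaDescent.eq_of_two_nsmul_eq_zero D.im D.im_sq
  rw [two_smul_galPt_genusPoint_sub hsq hodd hr1 D h35 hL0 h318 g hgi hgK, hsq2, sub_self]

/-! ## §3 On the line `P(n) ≡ m·Q₁`: `c_P = m·χ_{Q₁}` -/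

/-- **ON THE LINE, `c_P(g) = m·χ_{Q₁}(g)`** for every `g` fixing `i` (ODD `n`, Lemma 3.18): if `P(n) − m·Q₁` is torsion then
`g·P(n) − P(n) = m·(g·Q₁ − Q₁)`. [cite: TianYuanZhang2017, Lemma 3.18 (p0017 L152–L153)] -/
theorem galPt_genusPoint_sub_eq_zsmul_half_sub (D : GenusPointData n) (hodd : Odd n) (h318 : D.lemma318)
    (g : D.H ≃ₐ[ℚ] D.H) (hgi : g D.im = D.im) {Q₁ : APoint D.H} {m : ℤ}
    (hm : IsOfFinAddOrder (D.P n - m • Q₁)) :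
    D.galPt g (D.P n) - D.P n = m • (D.galPt g Q₁ - Q₁) := by
  have hfix := galPt_eq_self_of_isOfFinAddOrder D hodd h318 g hgi hm
  have e : D.P n = (D.P n - m • Q₁) + m • Q₁ := by abel
  conv_lhs => rw [e, map_add, hfix, map_zsmul]
  rw [e]
  module

/-- On the line with `m` EVEN, every `g` fixing `i` and `√−n` FIXES `P(n)` (`2·χ_{Q₁} = 0`; this is g4's B-locus reading through §3).
[cite: TianYuanZhang2017, Lemma 3.16 (p0017 L105–L113), Lemma 3.18 (p0017 L152–L153)] -/
theorem galPt_genusPoint_eq_of_mem_line_of_even (D : GenusPointData n) (hn : n ∈ n.divisors) (hodd : Odd n)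
    (h318 : D.lemma318) (g : D.H ≃ₐ[ℚ] D.H) (hgi : g D.im = D.im) (hgK : g (D.sqrtNeg n) = D.sqrtNeg n)
    {Q₁ : APoint D.H} {X : A2Point (GenusField n)}
    (hQ₁ : φH D Q₁ = Point.map (W' := curveA.twoIsogenyCodomain) (D.embK n hn) X) {m : ℤ} (hme : Even m)
    (hm : IsOfFinAddOrder (D.P n - m • Q₁)) : D.galPt g (D.P n) = D.P n := by
  obtain ⟨j, rfl⟩ := hme
  have h := galPt_genusPoint_sub_eq_zsmul_half_sub D hodd h318 g hgi hm
  have h2 : (j + j) • (D.galPt g Q₁ - Q₁) = 0 := by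
    rcases galPt_half_sub_eq_zero_or_eq_tauOne D hn g hgK hQ₁ with e | e
    · rw [e, smul_zero]
    · rw [e, ← two_mul, mul_comm, mul_smul, two_zsmul, ← two_nsmul, two_nsmul_tauOne, smul_zero]
  rwa [h2, sub_eq_zero] at h

/-- On the line with `m` ODD, `c_P(g) = χ_{Q₁}(g)` for every `g` fixing `i` and `√−n`.
[cite: TianYuanZhang2017, Lemma 3.16 (p0017 L105–L113), Lemma 3.18 (p0017 L152–L153)] -/
theorem galPt_genusPoint_sub_eq_half_sub_of_mem_line_of_odd (D : GenusPointData n) (hn : n ∈ n.divisors) (hodd : Odd n)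
    (h318 : D.lemma318) (g : D.H ≃ₐ[ℚ] D.H) (hgi : g D.im = D.im) (hgK : g (D.sqrtNeg n) = D.sqrtNeg n)
    {Q₁ : APoint D.H} {X : A2Point (GenusField n)}
    (hQ₁ : φH D Q₁ = Point.map (W' := curveA.twoIsogenyCodomain) (D.embK n hn) X) {m : ℤ} (hmo : Odd m)
    (hm : IsOfFinAddOrder (D.P n - m • Q₁)) : D.galPt g (D.P n) - D.P n = D.galPt g Q₁ - Q₁ := by
  obtain ⟨j, rfl⟩ := hmo
  have h := galPt_genusPoint_sub_eq_zsmul_half_sub D hodd h318 g hgi hm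
  have h2 : (j + j) • (D.galPt g Q₁ - Q₁) = 0 := by
    rcases galPt_half_sub_eq_zero_or_eq_tauOne D hn g hgK hQ₁ with e | e
    · rw [e, smul_zero]
    · rw [e, ← two_mul, mul_comm, mul_smul, two_zsmul, ← two_nsmul, two_nsmul_tauOne, smul_zero]
  rw [h, show (2 * j + 1) • (D.galPt g Q₁ - Q₁) = (j + j) • (D.galPt g Q₁ - Q₁) + (D.galPt g Q₁ - Q₁) by module, h2,
    zero_add]

/-- **ON THE LINE, A `g` FIXING `i` AND THE HALF-GENERATOR FIXES THE GENUS POINT** (ODD `n`, Lemma 3.18; any action on `√−n`): the only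
candidate movers of `P(n)` inside `Gal(ℍ′_n/ℚ(i))` are those that move `Q₁`. [cite: TianYuanZhang2017, Lemma 3.18 (p0017 L152–L153)] -/
theorem galPt_genusPoint_eq_of_half_fixed_of_mem_line (D : GenusPointData n) (hodd : Odd n) (h318 : D.lemma318)
    (g : D.H ≃ₐ[ℚ] D.H) (hgi : g D.im = D.im) {Q₁ : APoint D.H} (hfix : D.galPt g Q₁ = Q₁) {m : ℤ}
    (hm : IsOfFinAddOrder (D.P n - m • Q₁)) : D.galPt g (D.P n) = D.P n := by
  have h := galPt_genusPoint_sub_eq_zsmul_half_sub D hodd h318 g hgi hm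
  rwa [hfix, sub_self, smul_zero, sub_eq_zero] at h

/-! ## §4 On the lower-half locus, C⁺ is ONE BIT at a genus element moving the half-generator -/

/-- **C⁺ ⟹ MATCHING `c_P = χ_{Q₁}` on the stabiliser of `i`.** Square-free odd `n ≡ 5, 7 (mod 8)` of analytic rank one; GZK; data with
Thm 3.5, integrality, Lemma 3.18; `R`, `Q₁` as in g3.  If C⁺ holds at `n` then `g·P(n) − P(n) = g·Q₁ − Q₁` for every `g` fixing `i`
and `√−n`. [cite: TianYuanZhang2017, Thm. 3.5 (p0011 L94–L100), Lemma 3.18 (p0017 L152–L153)] [cite: Darmon2004, Thm. 3.22] -/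
theorem galPt_genusPoint_sub_eq_galPt_half_sub_of_levelTwo
    (hGZK : rank_eq_analyticRank_of_analyticRank_le_one) (hsq : Squarefree n)
    (h8 : n % 8 = 5 ∨ n % 8 = 7) (hr : (congruentNumberCurve n).analyticRank = 1)
    (D : GenusPointData n) (h35 : D.thm35Main) (hLs : D.scriptLSpec) (h318 : D.lemma318)
    {R : (congruentNumberCurve n).toAffine.Point} (hR : ∀ x, ∃ k : ℤ, IsOfFinAddOrder (x - k • R))
    {Q₁ : APoint D.H} (hQ₁ : φH D Q₁ = Point.map (W' := curveA.twoIsogenyCodomain)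
      (D.embK n (Nat.mem_divisors_self n hsq.ne_zero)) (ΘE hsq.ne_zero R))
    (hC : ∀ L : ℤ, IsScriptL n L → (2 : ℤ) ∣ L ∧ ¬ (4 : ℤ) ∣ L)
    (g : D.H ≃ₐ[ℚ] D.H) (hgi : g D.im = D.im) (hgK : g (D.sqrtNeg n) = D.sqrtNeg n) :
    D.galPt g (D.P n) - D.P n = D.galPt g Q₁ - Q₁ := by
  haveI := isElliptic_congruentNumberCurve hsq.ne_zero
  have hodd : Odd n := by rcases h8 with h | h <;> exact Nat.odd_iff.mpr (by omega)
  have h8' : n % 8 = 5 ∨ n % 8 = 6 ∨ n % 8 = 7 := by rcases h8 with h | h <;> omega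
  have hn : n ∈ n.divisors := Nat.mem_divisors_self n hsq.ne_zero
  obtain ⟨m, hmo, hm⟩ := (levelTwo_iff_genusPoint_odd_multiple_half hGZK hsq h8' hr D h35 hLs hR hQ₁).mp hC
  exact galPt_genusPoint_sub_eq_half_sub_of_mem_line_of_odd D hn hodd h318 g hgi hgK hQ₁ hmo hm

/-- **C⁺ AT `n` ⟺ `g₀` MOVES `P(n)` — given the LOWER half and ONE `g₀` fixing `i`, `√−n` and moving the half-generator.**  Square-free
odd `n ≡ 5, 7 (mod 8)` of analytic rank one; GZK; data with Thm 3.5, integrality, Lemma 3.18; `R` a generator of `E_n(ℚ)` mod torsion,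
`Q₁` a half of its twist; `2 ∣ L` for every sign choice `L` of `𝓛(n)`; `g₀·Q₁ ≠ Q₁`.  Then the conclusion of C⁺ at `n` holds iff
`g₀·P(n) ≠ P(n)`.  (⟹: `P ≡ m·Q₁`, `m` odd, `c_P(g₀) = χ_{Q₁}(g₀) ≠ 0`; ⟸: g4's door gives `4 ∤ 𝓛`.)
[cite: TianYuanZhang2017, Thm. 3.5 (p0011 L94–L100), Lemma 3.18 (p0017 L152–L153)] [cite: Darmon2004, Thm. 3.22] -/
theorem levelTwo_iff_galPt_genusPoint_ne_of_two_dvd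
    (hGZK : rank_eq_analyticRank_of_analyticRank_le_one) (hsq : Squarefree n)
    (h8 : n % 8 = 5 ∨ n % 8 = 7) (hr : (congruentNumberCurve n).analyticRank = 1)
    (D : GenusPointData n) (h35 : D.thm35Main) (hLs : D.scriptLSpec) (h318 : D.lemma318)
    {R : (congruentNumberCurve n).toAffine.Point} (hR : ∀ x, ∃ k : ℤ, IsOfFinAddOrder (x - k • R))
    {Q₁ : APoint D.H} (hQ₁ : φH D Q₁ = Point.map (W' := curveA.twoIsogenyCodomain)
      (D.embK n (Nat.mem_divisors_self n hsq.ne_zero)) (ΘE hsq.ne_zero R))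
    (h2 : ∀ L : ℤ, IsScriptL n L → (2 : ℤ) ∣ L)
    (g₀ : D.H ≃ₐ[ℚ] D.H) (hgi : g₀ D.im = D.im) (hgK : g₀ (D.sqrtNeg n) = D.sqrtNeg n)
    (hmoveQ : D.galPt g₀ Q₁ ≠ Q₁) :
    (∀ L : ℤ, IsScriptL n L → (2 : ℤ) ∣ L ∧ ¬ (4 : ℤ) ∣ L) ↔ D.galPt g₀ (D.P n) ≠ D.P n := by
  haveI := isElliptic_congruentNumberCurve hsq.ne_zero
  constructor
  · intro hC hP
    apply hmoveQ
    have h := galPt_genusPoint_sub_eq_galPt_half_sub_of_levelTwo hGZK hsq h8 hr D h35 hLs h318 hR hQ₁ hC g₀ hgi hgK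
    rw [hP, sub_self] at h
    exact (sub_eq_zero.mp h.symm)
  · intro hmove L hL
    exact ⟨h2 L hL, not_four_dvd_of_galPt_genusPoint_ne hGZK hsq h8 hr D h35 hLs h318 g₀ hgi hgK hmove L hL⟩

/-- **ON THE VISIBLE PART WITH A HALF-MOVER, C⁺ ⟺ ONE BIT**: same data with `Q₁ ∉ 2A(ℍ′_n) + tors` instead of the lower half (which
then holds by `…LevelTwoHalves`): C⁺ at `n` ⟺ `g₀·P(n) ≠ P(n)`.
[cite: TianYuanZhang2017, Thm. 3.5 (p0011 L94–L100), Lemma 3.18 (p0017 L152–L153)] [cite: Darmon2004, Thm. 3.22] -/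
theorem levelTwo_iff_galPt_genusPoint_ne_of_half_not_twoDivisible
    (hGZK : rank_eq_analyticRank_of_analyticRank_le_one) (hsq : Squarefree n)
    (h8 : n % 8 = 5 ∨ n % 8 = 7) (hr : (congruentNumberCurve n).analyticRank = 1)
    (D : GenusPointData n) (h35 : D.thm35Main) (hLs : D.scriptLSpec) (h318 : D.lemma318)
    {R : (congruentNumberCurve n).toAffine.Point} (hR : ∀ x, ∃ k : ℤ, IsOfFinAddOrder (x - k • R))
    {Q₁ : APoint D.H} (hQ₁ : φH D Q₁ = Point.map (W' := curveA.twoIsogenyCodomain)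
      (D.embK n (Nat.mem_divisors_self n hsq.ne_zero)) (ΘE hsq.ne_zero R))
    (hQ2 : ¬ ∃ y : APoint D.H, IsOfFinAddOrder (Q₁ - (2 : ℤ) • y))
    (g₀ : D.H ≃ₐ[ℚ] D.H) (hgi : g₀ D.im = D.im) (hgK : g₀ (D.sqrtNeg n) = D.sqrtNeg n)
    (hmoveQ : D.galPt g₀ Q₁ ≠ Q₁) :
    (∀ L : ℤ, IsScriptL n L → (2 : ℤ) ∣ L ∧ ¬ (4 : ℤ) ∣ L) ↔ D.galPt g₀ (D.P n) ≠ D.P n := by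
  haveI := isElliptic_congruentNumberCurve hsq.ne_zero
  have hn1 : 1 < n := by rcases h8 with h | h <;> omega
  exact levelTwo_iff_galPt_genusPoint_ne_of_two_dvd hGZK hsq h8 hr D h35 hLs h318 hR hQ₁
    (two_dvd_scriptL_of_half_not_twoDivisible hGZK hsq hr D h35 hLs hn1 hR hQ₁ hQ2) g₀ hgi hgK hmoveQ

end Summit.BirchSwinnertonDyer.PrintCf2.GenusCharacter

end
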